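import Literature.Barriers.MatrixMultiplication.IrreversibilityBarrierProp5
import Literature.Computability.AlgebraicComplexity.RelativeExponentTriangle
import Literature.Computability.AlgebraicComplexity.MatMulMonomialSubrankAsymptotics
import HarnessLib

/-!
# Proof of the irreversibility barrier, CVZ 2021 Thm. 9 (`CVZ2021_thm9_holds`)

Topic `Literature/Barriers/MatrixMultiplication`; DISCHARGE of the named fact `CVZ2021_thm9` of
`IrreversibilityBarrier.lean` (M. Christandl, P. Vrana, J. Zuiddam, *Barriers for fast matrix
multiplication from irreversibility*, Theory of Computing 17 (2021), art. 2 = arXiv:1812.06952,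
**arXiv numbering**, Thm. 9 and its proof, §3.1 p. 7):
`ω(⟨2⟩, t) · ω(t, ⟨2,2,2⟩) ≥ 2 i(t)` for every tensor `t` (not of the form `u ⊗ v ⊗ w`).

## The printed proof and its formal counterpart

CVZ (p. 7): "By the triangle inequality,
`ω(⟨2⟩,t) ω(t,⟨2,2,2⟩) ω(⟨2,2,2⟩,⟨2⟩) ≥ ω(⟨2⟩,t) ω(t,⟨2⟩) = i(t)`. Therefore, using the fact
`ω(⟨2,2,2⟩,⟨2⟩) = 1/2` from (2.5), `ω(⟨2⟩,t) ω(t,⟨2,2,2⟩) ≥ i(t)/ω(⟨2,2,2⟩,⟨2⟩) = 2 i(t)`."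
Only the upper bound `ω(⟨2,2,2⟩,⟨2⟩) ≤ 1/2` is used, and after cancelling the common factor
`ω(⟨2⟩,t) ≥ 0` the content of Thm. 9 is the **rate inequality**
`2 ω(t,⟨2⟩) ≤ ω(t,⟨2,2,2⟩)` (`two_mul_relativeExponent_unit_le`), which holds for EVERY `t` (the
discharge does not use Assumption 1). Both printed ingredients are in the tree:

* the triangle inequality `ω(t,⟨2⟩) ≤ ω(t,⟨2,2,2⟩) · ω(⟨2,2,2⟩,⟨2⟩)` is
  `relativeExponent_triangle` (`RelativeExponentTriangle.lean`, CVZ Prop. 3), valid for the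
  tree's infimum formalisation (`RelativeExponent.lean`) whenever every set defining the two
  factors is nonempty;
* `ω(⟨2,2,2⟩,⟨2⟩) ≤ 1/2` (`relativeExponent_matMul_unit_le_half`, CVZ (2.5) =
  Strassen's `Q̃(⟨h,h,h⟩) = h²` in the direction `Q̃(⟨2,2,2⟩) ≥ 4`) follows from the witnesses
  `⟨2,2,2⟩^{⊗L} ≥_M ⟨2⟩^{⊗r}`, `r ≥ (2-ε)L`, of `MatMulMonomialSubrankAsymptotics.lean`
  (Ruzsa–Szemerédi induced matchings of `⟨n,n,n⟩` fed with Behrend's progression-free sets; a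
  monomial restriction is a restriction), which also make every set defining `ω(⟨2,2,2⟩,⟨2⟩)`
  nonempty (`exists_matMul_pow_restrictsTo_unit_pow`).

The junk case of the infimum formalisation (some set `{k | t^{⊗k} ≥ ⟨2,2,2⟩^{⊗(p+1)}}` empty, so
`ω(t,⟨2,2,2⟩) = 0`; in print `ω(t,⟨2,2,2⟩) = ∞` and Thm. 9 is vacuous) is settled separately: then
also `ω(t,⟨2⟩) = 0`, because a witness `t^{⊗m} ≥ ⟨2⟩^{⊗(k+1)}` composed with `⟨2⟩^{⊗k} ≥
⟨2,2,2⟩^{⊗(p+1)}` (`exists_unitTensor_pow_restrictsTo`, `IrreversibilityBarrierProp5.lean`) would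
fill the empty set.

## Content

* `unitTensor_two_pow_restrictsTo_pow` — `⟨2⟩^{⊗r} ≥ ⟨2⟩^{⊗n}` for `n ≤ r`;
  `exists_matMul_pow_restrictsTo_unit_pow` — every set defining `ω(⟨2,2,2⟩,⟨2⟩)` is nonempty;
  `relativeExponent_matMul_unit_le_half` — **`ω(⟨2,2,2⟩, ⟨2⟩) ≤ 1/2`** (CVZ (2.5), upper half).
* `two_mul_relativeExponent_unit_le` — **`2 ω(t, ⟨2⟩) ≤ ω(t, ⟨2,2,2⟩)`** for every `t`;
  `two_mul_irreversibility_le` — `2 i(t) ≤ ω(⟨2⟩,t) ω(t,⟨2,2,2⟩)` for every `t`.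
* `CVZ2021_thm9_holds : CVZ2021_thm9` — the discharge; `two_lt_of_one_lt_irreversibility` — CVZ's
  reading "one cannot prove `ω = 2` via any fixed irreversible intermediate tensor", now
  unconditional (the corollaries `CVZ2021_thm9.two_lt/.bound_ge`, `CVZ2021_thm19.cw_barrier`,
  `CVZ2021_thm22.bigCw_barrier`, `IrreversibilityBarrier.thm9` of `IrreversibilityBarrier.lean` can
  be fed `CVZ2021_thm9_holds`).

## References

* M. Christandl, P. Vrana, J. Zuiddam, ToC 17 (2021), art. 2 = arXiv:1812.06952: Def. 2, Prop. 3,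
  Def. 4 (p. 5), eq. (2.5) `ω(⟨2,2,2⟩,⟨2⟩) = 1/2` (§2.2), Thm. 9 and its proof (§3.1, p. 7).
  [ChristandlVranaZuiddam2021]
* V. Strassen, J. reine angew. Math. 384 (1988) — `Q̃(⟨h,h,h⟩) = h²`, cited through CVZ §2.1.
  [Strassen1988]
-/

noncomputable section

open scoped BigOperators

namespace Literature.Barriers.MatrixMultiplication

open Literature.Computability.AlgebraicComplexity

universe u

/-! ## `ω(⟨2,2,2⟩, ⟨2⟩) ≤ 1/2` for plain restriction -/

section Half

variable (K : Type u) [CommSemiring K]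

/-- `⟨2⟩^{⊗r} ≥ ⟨2⟩^{⊗n}` for `n ≤ r` (`⟨2⟩^{⊗r} ≅ ⟨2^r⟩ ≥ ⟨2^n⟩ ≅ ⟨2⟩^{⊗n}`). [folklore] -/
theorem unitTensor_two_pow_restrictsTo_pow {n r : ℕ} (h : n ≤ r) :
    TensorRestrictsTo (kroneckerPow (unitTensor K 2) r) (kroneckerPow (unitTensor K 2) n) :=
  ((tensorMonRestrictsTo_pow_unitTensor (K := K) 2 r).tensorRestrictsTo.trans
    (tensorMonRestrictsTo_unitTensor_castLE (K := K) (Nat.pow_le_pow_right two_pos h)).tensorRestrictsTo).trans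
    (tensorMonRestrictsTo_unitTensor_pow (K := K) 2 n).tensorRestrictsTo

/-- Every set `{m | ⟨2,2,2⟩^{⊗m} ≥ ⟨2⟩^{⊗(n+1)}}` defining `ω(⟨2,2,2⟩, ⟨2⟩)` is nonempty (from the
Ruzsa–Szemerédi/Behrend witnesses `⟨2,2,2⟩^{⊗L} ≥_M ⟨2⟩^{⊗r}`, `r ≥ L`, of
`MatMulMonomialSubrankAsymptotics.lean`). [cite: ChristandlVranaZuiddam2021, §2.2] -/
theorem exists_matMul_pow_restrictsTo_unit_pow (n : ℕ) :
    ∃ m, TensorRestrictsTo (kroneckerPow (matMulTensor K 2 2 2) m)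
      (kroneckerPow (unitTensor K 2) (n + 1)) := by
  obtain ⟨L₀, hL₀⟩ :=
    exists_tensorMonRestrictsTo_kroneckerPow_matMulTensor_unitTensor K one_pos le_rfl
  obtain ⟨r, hr, hMU⟩ := hL₀ (max L₀ (n + 1)) (le_max_left _ _)
  have hnr : n + 1 ≤ r := by
    have h1 : ((max L₀ (n + 1) : ℕ) : ℝ) ≤ r := by linarith
    have h2 : n + 1 ≤ max L₀ (n + 1) := le_max_right _ _
    exact_mod_cast (show ((n + 1 : ℕ) : ℝ) ≤ r from le_trans (by exact_mod_cast h2) h1)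
  exact ⟨_, hMU.tensorRestrictsTo.trans (unitTensor_two_pow_restrictsTo_pow K hnr)⟩

/-- **CVZ (2.5), upper half: `ω(⟨2,2,2⟩, ⟨2⟩) ≤ 1/2`** for the tree's `relativeExponent` (plain
restriction), i.e. Strassen's `Q̃(⟨2,2,2⟩) ≥ 4` in rate form: the monomial witnesses
`⟨2,2,2⟩^{⊗L} ≥_M ⟨2⟩^{⊗r}` with `r ≥ (2-ε)L` (`MatMulMonomialSubrankAsymptotics.lean`) are
restrictions of ratio `L/r ≤ 1/2 + ε`. [cite: ChristandlVranaZuiddam2021, §2.2] -/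
theorem relativeExponent_matMul_unit_le_half :
    relativeExponent (matMulTensor K 2 2 2) (unitTensor K 2) ≤ 1 / 2 := by
  refine relativeExponent_le_of_forall_pos fun ε hε => ?_
  set ε' : ℝ := min ε 1 with hε'
  have hε'0 : 0 < ε' := lt_min hε one_pos
  have hε'1 : ε' ≤ 1 := min_le_right _ _
  have hε'ε : ε' ≤ ε := min_le_left _ _
  obtain ⟨L₀, hL₀⟩ := exists_tensorMonRestrictsTo_kroneckerPow_matMulTensor_unitTensor K hε'0 hε'1
  set L : ℕ := max L₀ 1 with hL
  obtain ⟨r, hr, hMU⟩ := hL₀ L (le_max_left _ _)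
  have hL1 : (1 : ℝ) ≤ L := by exact_mod_cast (le_max_right _ _ : 1 ≤ L)
  have hr1 : 1 ≤ r := by
    have : (1 : ℝ) ≤ r := by nlinarith
    exact_mod_cast this
  obtain ⟨n, rfl⟩ : ∃ n, r = n + 1 := ⟨r - 1, by omega⟩
  refine ⟨n, L, hMU.tensorRestrictsTo, ?_⟩
  push_cast at hr
  have hpos : (0 : ℝ) < (n : ℝ) + 1 := by positivity
  rw [div_le_iff₀ hpos]
  -- `L ≤ (1/2 + ε')(2 - ε') L ≤ (1/2 + ε') (n+1)`
  have hc : 1 ≤ (1 / 2 + ε') * (2 - ε') := by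
    have : 0 ≤ ε' * (3 / 2 - ε') := mul_nonneg hε'0.le (by linarith)
    nlinarith
  have h1 : (L : ℝ) ≤ (1 / 2 + ε') * ((2 - ε') * L) := by
    have hL0 : (0 : ℝ) ≤ L := by positivity
    calc (L : ℝ) = 1 * L := by ring
      _ ≤ ((1 / 2 + ε') * (2 - ε')) * L := mul_le_mul_of_nonneg_right hc hL0
      _ = (1 / 2 + ε') * ((2 - ε') * L) := by ring
  have h2 : (1 / 2 + ε') * ((2 - ε') * L) ≤ (1 / 2 + ε') * ((n : ℝ) + 1) :=
    mul_le_mul_of_nonneg_left hr (by linarith)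
  have h3 : (1 / 2 + ε') * ((n : ℝ) + 1) ≤ (1 / 2 + ε) * ((n : ℝ) + 1) := by gcongr
  linarith

end Half

/-! ## The rate inequality and the discharge -/

section Rate

variable {K : Type u} [CommSemiring K]
variable {ι κ μ : Type*} [Fintype ι] [Fintype κ] [Fintype μ]

/-- **The rate inequality behind CVZ Thm. 9: `2 ω(t, ⟨2⟩) ≤ ω(t, ⟨2,2,2⟩)` for every tensor `t`**
(CVZ, proof of Thm. 9: the triangle inequality `ω(t,⟨2⟩) ≤ ω(t,⟨2,2,2⟩) ω(⟨2,2,2⟩,⟨2⟩)`, Prop. 3,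
and `ω(⟨2,2,2⟩,⟨2⟩) ≤ 1/2`, eq. (2.5)); the junk case `ω(t,⟨2,2,2⟩) = 0` of the infimum
formalisation forces `ω(t,⟨2⟩) = 0` (module docstring). [cite: ChristandlVranaZuiddam2021, Thm. 9 (proof)] -/
theorem two_mul_relativeExponent_unit_le (t : ι → κ → μ → K) :
    2 * relativeExponent t (unitTensor K 2) ≤ relativeExponent t (matMulTensor K 2 2 2) := by
  by_cases hst : ∀ p, ∃ k, TensorRestrictsTo (kroneckerPow t k)
      (kroneckerPow (matMulTensor K 2 2 2) (p + 1))
  · -- the printed proof: triangle inequality and `ω(⟨2,2,2⟩,⟨2⟩) ≤ 1/2`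
    have htri : relativeExponent t (unitTensor K 2) ≤ relativeExponent t (matMulTensor K 2 2 2) *
        relativeExponent (matMulTensor K 2 2 2) (unitTensor K 2) :=
      relativeExponent_triangle hst (exists_matMul_pow_restrictsTo_unit_pow K)
    have hM0 : 0 ≤ relativeExponent t (matMulTensor K 2 2 2) := relativeExponent_nonneg _ _
    have hhalf := relativeExponent_matMul_unit_le_half K
    have := mul_le_mul_of_nonneg_left hhalf hM0
    linarith
  · -- junk case: a set defining `ω(t,⟨2,2,2⟩)` is empty, so `ω(t,⟨2,2,2⟩) = 0 = ω(t,⟨2⟩)`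
    obtain ⟨p, hp⟩ := not_forall.1 hst
    have hM : relativeExponent t (matMulTensor K 2 2 2) = 0 :=
      relativeExponent_eq_zero_of_not_exists hp
    obtain ⟨k, hk⟩ := exists_unitTensor_pow_restrictsTo (K := K)
      (kroneckerPow (matMulTensor K 2 2 2) (p + 1))
    have hU : relativeExponent t (unitTensor K 2) = 0 := by
      refine relativeExponent_eq_zero_of_not_exists (n := k) ?_
      rintro ⟨m, hm⟩
      exact hp ⟨m, (hm.trans (unitTensor_two_pow_restrictsTo_pow K (Nat.le_succ k))).trans hk⟩
    rw [hM, hU, mul_zero]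

/-- The hypothesis-free form of Thm. 9: `2 i(t) ≤ ω(⟨2⟩,t) ω(t,⟨2,2,2⟩)` for EVERY tensor `t` over a
commutative semiring (Assumption 1 is not needed for the inequality: multiply
`two_mul_relativeExponent_unit_le` by `ω(⟨2⟩,t) ≥ 0`). [cite: ChristandlVranaZuiddam2021, Thm. 9] -/
theorem two_mul_irreversibility_le (t : ι → κ → μ → K) :
    2 * irreversibility t ≤
      relativeExponent (unitTensor K 2) t * relativeExponent t (matMulTensor K 2 2 2) := by
  have h := two_mul_relativeExponent_unit_le t
  have h0 := relativeExponent_nonneg (unitTensor K 2) t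
  calc 2 * irreversibility t
      = relativeExponent (unitTensor K 2) t * (2 * relativeExponent t (unitTensor K 2)) := by
        rw [irreversibility]; ring
    _ ≤ relativeExponent (unitTensor K 2) t * relativeExponent t (matMulTensor K 2 2 2) :=
        mul_le_mul_of_nonneg_left h h0

end Rate

section Discharge

/-- **CVZ 2021, Theorem 9 (the irreversibility barrier), PROVED**: for every tensor `t` over any
field (not of the form `u ⊗ v ⊗ w`), `ω(⟨2⟩, t) · ω(t, ⟨2,2,2⟩) ≥ 2 · i(t)` — discharge of the named
fact `CVZ2021_thm9` by `two_mul_irreversibility_le` (printed proof: triangle inequality and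
`ω(⟨2,2,2⟩,⟨2⟩) = 1/2`). [cite: ChristandlVranaZuiddam2021, Thm. 9] -/
theorem CVZ2021_thm9_holds : CVZ2021_thm9 := by
  intro K _ ι κ μ _ _ _ t _
  exact two_mul_irreversibility_le t

/-- CVZ §3.1, now unconditional: an irreversible intermediate tensor (`i(t) > 1`) certifies only
bounds `ω(⟨2⟩,t) ω(t,⟨2,2,2⟩) > 2` ("one cannot prove `ω = 2` via any fixed irreversible
intermediate tensor"). [cite: ChristandlVranaZuiddam2021, §3.1] -/
theorem two_lt_of_one_lt_irreversibility {K : Type} [Field K] {ι κ μ : Type} [Fintype ι]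
    [Fintype κ] [Fintype μ] (t : ι → κ → μ → K) (ht : ∀ w u v, t ≠ triad w u v)
    (hirr : 1 < irreversibility t) :
    2 < relativeExponent (unitTensor K 2) t * relativeExponent t (matMulTensor K 2 2 2) :=
  CVZ2021_thm9.two_lt CVZ2021_thm9_holds t ht hirr

/-- The catalogue entry's first conjunct holds: `IrreversibilityBarrier` reduces to
`CVZ2021_thm13 ∧ CVZ2021_thm19 ∧ CVZ2021_thm22`. [cite: ChristandlVranaZuiddam2021, Thm. 9] -/
theorem irreversibilityBarrier_of (h13 : CVZ2021_thm13) (h19 : CVZ2021_thm19)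
    (h22 : CVZ2021_thm22) : IrreversibilityBarrier :=
  ⟨CVZ2021_thm9_holds, h13, h19, h22⟩

end Discharge

end Literature.Barriers.MatrixMultiplication

end
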